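import Summits.AnomalousDissipation.AnomalousDissipation.Theorems.QuarticGate.Negative.EnergyRow
import Summits.AnomalousDissipation.AnomalousDissipation.Theorems.QuarticGate.Negative.Laminar
import Summits.AnomalousDissipation.AnomalousDissipation.Theorems.CubicParityLoud.Negative.MeanFlow

/-!
# Disproof of `MomentLadder` — findings of the standing adversary (cdisprove, stmt-AnomalousDissipation-11463)

Crux: `Summit.AnomalousDissipation.AnomalousDissipation.Theses.MomentParity.MomentLadder` (route
MomentParity, rank 0, the route's target `X`): `∃ f` smooth div-free mean-zero, `ν_j → 0`, `E`, `ε > 0`,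
`∀ j ∃ R κ, ∃ᶠ N, ∀ d, ∃ μ` probability on `H = L²_σ(T³)`: level-`N` carried, supported in `‖u‖ ≤ R`,
`κ`-RESOLVED (`∫‖∇u‖² ≤ ∫‖∇P_{κ n}u‖² + 1/(n+1)` for all `n`), `d`-STATIONARY for Galerkin NS at
`(ν_j, f)` (rows of all polynomial cylindrical tests of total degree `≤ d − 1` with level-`N` band tests
vanish), `ensembleEnergy μ ≤ E`, `ε ≤ ensembleDissipation ν_j μ`. Restated definitionally as
`momentLadder_iff` over `IsLadderWitness f ν N E ε R κ d μ` = the landed `QuarticGate` vocabulary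
(`IsLevel`, `IsBandTest`, `polyGrad`, `IsPolyStationary`, `Theorems/QuarticGate/Negative/LevelCeiling.lean`)
plus the two clauses new to the ladder, `IsSupported R μ` and `IsResolved κ μ`.

## Verdict (cycle 1, 2026-08-16): NO KILL — why it resists

* SHAPE (`not_momentLadder_iff`). An `∃`-crux over measures dies only by a UNIVERSAL QUIETNESS
  THEOREM: for every admissible force and every `ν_j → 0`, some `ν_j` admits, for every radius `R` and
  schedule `κ`, eventually in `N`, an order `d` with no loud supported resolved `d`-stationary law. By the
  (provable-now) support item `MomentClosure` the `∀ d ∃ μ` at fixed `(N, R, κ)` is one Galerkin-INVARIANT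
  law, so `¬X` = "every bounded-energy family of invariant measures of 3-D Galerkin NS laminarises
  (`ν⟨‖∇u‖²⟩ = (f, ū) → 0`) N-frequently as `ν → 0`, OR leaks enstrophy past every fixed cutoff as
  `N → ∞` at fixed `ν`" — the first disjunct is a no-zeroth-law theorem for converged DNS ensembles
  (open, believed false; its 2-D analogue is TRUE: `PlanarCubicQuiet` = Alexakis–Doering, and the
  gravest-mode Marchioro barrier is 2-D only — `Literature/Barriers/AnomalousDissipation/GravestModeLaminarAttractor`
  records that 3-D gravest-mode forcing is subcritically turbulent), the second is an enstrophy-leakage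
  theorem at fixed `ν > 0` for ALL loud invariant families (it would contradict resolved-DNS practice,
  Kaneda et al. 2003; provably absent for steady Diracs by the elliptic bootstrap). Neither is within reach.
* `X ⇒ QuarticGate` (`not_momentLadder_of_not_quarticGate`, the `d = 4` rung; bounded support gives the
  fourth moments): every negative fact on the sibling crux transfers, and the sibling seat's verdict
  (cdisprove stmt-11464: no kill; the typed `QuarticGate` is very probably TRUE via line `recession-cone`)
  says the cheap tiers (`d ≤ 4`) of the ladder will not break. The content of `X` above `QuarticGate` is
  exactly `QuarticTightness` + `UniformResolution` (route items 14331/14330) — both conditional, both open.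
* The two clauses NEW to the ladder are NOT load-bearing for non-triviality: dropping `IsSupported` or
  `IsResolved` leaves a statement that still implies `QuarticGate`. They are there for the assembly
  (`MomentClosure` needs the common compact support; `GalerkinEnsembleRealization` needs no leakage), and
  on the laminar branch they cost nothing (§D: radius `a_j`, schedule `κ ≡ 1`).
* No formalisation glitch found: the body elaborates (`W.lean` rc 0), `momentLadder_iff` is `Iff.rfl`,
  all junk values are excluded on witnesses (bounded support ⇒ every moment finite ⇒ `ensembleEnergy`,
  `ensembleDissipation` are genuine; level-`N` fields have finite spectral enstrophy; rows are continuous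
  in `u`), `d = 0, 1` rows are vacuous/zero, `d = 2` is the mean-momentum balance, `d = 3` gives the exact
  energy row (§C). Degenerate parameters are all quiet for the right reason: `N = 0` (`not_isLadderWitness_level_zero`),
  `f = 0` (`force_not_ae_zero`), bounded `N` (§A), bounded `κ` (§B).

## What IS proved here (sorry-free; LANDED under `Theorems/MomentLadder/Negative/{Clauses,EnergyRow,LoadBearing}.lean` — p84288, p84829, p84870, all ACCEPTED 2026-08-16)

(0) TRANSFER: `IsLadderWitness.isQuarticWitness`, `not_momentLadder_of_not_quarticGate`.
(A) LEVEL CEILING: `IsLadderWitness.eps_le_level` (`ε ≤ 4π²N²ν_jE`, stationarity unused),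
    `not_momentLadderBoundedLevel` — the strengthening with `N` chosen before `j` is FALSE.
(B) RESOLUTION FLOOR (new to this crux): `eGradNormSq_fourierTruncate_le_sq_mul` (Bernstein for `P_K`),
    `IsResolved.ensembleEnstrophy_le`, `ensembleDissipation_le_of_isResolved`,
    `IsLadderWitness.eps_le_resolution` (`ε ≤ ν_j(4π²κ_j(n)²E + 1/(n+1))` for EVERY `n`, level and
    stationarity unused), `IsLadderWitness.resolution_floor` (`ε/ν_j − 1/(n+1) ≤ 4π²κ_j(n)²E`),
    `not_momentLadderUniformResolution` — the strengthening with `κ` chosen before `j` is FALSE: the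
    dissipation range of any witnessing family escapes to infinity at least like `κ_j ≳ ν_j^{-1/2}`; what the
    crux asks is only that it does so uniformly in `N` at each fixed `j`. Monotonicity for provers:
    `IsResolved.mono` (finer schedules resolve), `IsSupported.mono`, `IsLadderWitness.mono_d`.
(C) ENERGY ROW / FLOORS (`d ≥ 3`, via the landed sibling energy row): `IsLadderWitness.dissipation_eq`
    (`ν∫‖∇u‖²dμ = ∫(u,f)dμ` EXACTLY), `eps_le_force` (`ε ≤ ‖f‖₂√E`), `eps_le_force_mul_radius`
    (`ε ≤ ‖f‖₂R`: the support radius cannot shrink below `ε/‖f‖₂`), `force_not_ae_zero`,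
    `not_momentLadderEveryForce` (the `∀ f` strengthening is FALSE), `not_momentLadderSubFloor`
    (`‖f‖₂√E < ε` is FALSE; tight by the laminar Dirac).
(D) LOAD-BEARING: `momentLadderWithoutEpsPos_holds` (`δ₀`, `f = 0`: every clause but loudness is jointly
    satisfiable at every order), `momentLadderWithoutEnergyCeiling_holds` (laminar Kolmogorov Diracs
    `δ_{[K_{a_j}]}`, `a_j = (4π²ν_j)⁻¹`, radius `a_j`, `κ ≡ 1`, stationary at EVERY order, dissipation
    `(8π²ν_j)⁻¹`), `momentLadderWithoutVanishingViscosity_holds` (`ν ≡ 1`, same Dirac, attaining the force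
    floor). Table: `0 < ε`, `ensembleEnergy ≤ E`, `ν_j → 0`, unbounded `∃ᶠ N`, `j`-dependent `κ`, `∃ f`
    are each necessary (D, D, D, A, B, C); `IsSupported`/`IsResolved` are not (see above).
(E) SHAPE: `not_momentLadder_iff`.
(G) LAMINAR CEILING (`d ≥ 3`, via the sibling `CubicParityLoud` witness bundle, `IsLadderWitness.isCubicWitness`):
    `IsLadderWitness.eps_le_laminar` (`ε ≤ ‖f‖₂²/(4π²ν_j)` for every `j`: `sup_j ν_j ≤ ‖f‖₂²/(4π²ε)`),
    `not_momentLadderBudgetsBeforeViscosities` — budgets chosen before the viscosity sequence is FALSE.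
(F) MEAN FLOW (`d ≥ 3`): `meanState μ = ∫ u dμ ∈ H` (Bochner), `integral_pairing_eq_pairing_meanState`,
    `IsLadderWitness.dissipation_eq_pairing_meanState` (`ν∫‖∇u‖²dμ = (ū, f)`), `meanFlow_floor`
    (`ε ≤ (ū,f) ≤ ‖f‖₂‖ū‖`, `‖ū‖ ≤ √E`), `meanState_ne_zero`, `not_momentLadderZeroMeanFlow` — the
    strengthening with a zero-mean (symmetric / isotropic / Gibbs-equilibrium) witnessing family is FALSE.

## Prover-facing consequences (numbers, not adjectives)
Any witness family has: `N ≥ (ε/(4π²ν_jE))^{1/2}`; `κ_j(n)² ≥ (ε/ν_j − 1/(n+1))/(4π²E)` for all `n`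
(so `κ_j(0) ≳ ν_j^{-1/2}` — the resolution cutoff sits at or beyond the Taylor wavenumber, and the
clause is an absolute `1/(n+1)` tail of a total enstrophy `≍ ε/ν_j`, i.e. a RELATIVE accuracy `ν_j/(ε(n+1))`);
`E ≥ (ε/‖f‖₂)²`; `R_j ≥ ε/‖f‖₂`; dissipation `= ∫(u,f)dμ` (mean flow correlated with the force).

## Attacks tried (cycle 1)
degenerate forces (`f = 0`), levels (`N = 0`, bounded `N`), schedules (bounded `κ`), radii (`R < ε/‖f‖₂`),
energies (`E < (ε/‖f‖₂)²`) — all quiet, recorded as refuted strengthenings / floors; junk-value hunt on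
every functional of the body — none bites a witness; transfer to the sibling cruxes' negative knowledge
(`QuarticGate`, `CubicParityLoud` Negative lanes) — consistent, nothing new kills; barrier catalogue
(`Literature/Barriers/AnomalousDissipation/*`: 2-D / gravest-mode / continuum / negative-proof barriers) —
none bites a 3-D Galerkin-level measure construction; negatives index (`ledger negatives`: 2979, 13037,
2984, 2859) — unrelated shapes (certificate / trajectory statements).

## Literature (negative results in print?) — searched 2026-08-16 (searchd FTS down, OpenAlex/arXiv 429; S2 + Crossref live)
No 3-D quietness theorem exists for Galerkin or Leray–Hopf ensembles at fixed force: the printed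
no-anomalous-dissipation results are 2-D (De Rosa–Park 2024 doi:10.1137/25m1773167; Tran–Dritschel 2006
doi:10.1017/s0022112006000577, enstrophy; Alexakis–Doering 2006 = `PlanarCubicQuiet`), conditional on Euler
regularity / boundary set-ups (Bardos–Boutros–Titi 2025 arXiv:2509.12432, Navier walls), or dual-side
formulas without a sign (Bronzi–Mondaini–Rosa 2026 arXiv:2606.12825, minimax for stationary statistical
solutions). Physical evidence points the other way: DNS of the 3-D periodic Kolmogorov flow keeps a sinusoidal
mean profile of `O(1)` amplitude with a drag/friction coefficient tending to a constant as `Re → ∞`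
(Borue–Orszag 1996 doi:10.1017/s0022112096001310; Musacchio–Boffetta 2014 doi:10.1103/PhysRevE.89.023004),
i.e. `(f, ū)` bounded below at bounded energy — exactly the mean-flow floor of §F realised. The leakage
disjunct (fixed `ν`, `N → ∞`) is contradicted by resolved-DNS convergence practice (Kaneda et al. 2003
doi:10.1063/1.1539855) and holds provably for steady Diracs; thermalisation at the cutoff is a truncated-EULER
phenomenon (Cichowlas et al. 2005 doi:10.1103/physrevlett.95.264502), not fixed-`ν` NS with `N ≫ k_η`.

## Computations (kit, batched; evidence attached to the item: compute-j014659.json; table `~/compute/j014659/outputs/table.md`)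
Alias-free spherical Galerkin NS on the unit torus (`0 < |k|² ≤ N²`, grid `M ≥ 3N+1`, IFRK4), force
`f = F0 sin(4πy) e_x` (`k_f = 2`, `F0 = 0.1·16π² = 15.79`, laminar amplitude `U_lam = 0.1/ν`); long-time averages over
`t ∈ [6, 24]` = Krylov–Bogoliubov proxies for level-`N` invariant measures (energy balance `⟨(f,u)⟩/ν⟨‖∇u‖²⟩ = 1.000 ± 0.001`
in every run — the energy row of §C, numerically).
* (B) RESOLUTION AT FIXED `ν = 0.02` (`k_η ≈ 4.95`), `N = 6, 8, 11, 16, 21` (`N/k_η = 1.2 … 4.2`): `E = ⟨|u|²⟩ = 4.34, 4.31,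
  4.32, 4.24, 4.31`; `ε = ν⟨‖∇u‖²⟩ = 7.50, 7.47, 7.50, 7.58, 7.48`; mean-flow amplitude `U1 = 0.953, 0.949, 0.953, 0.961,
  0.950` (laminar `5.0`); time-averaged enstrophy FRACTION ABOVE `κ`: `κ = 2`: `0.390, 0.396, 0.395, 0.405, 0.395`;
  `κ = 4`: `0.0129, 0.0124, 0.0124, 0.0168, 0.0124`; `κ = 6`: `–, 6.2e-4, 6.0e-4, 1.1e-3, 6.0e-4`; `κ = 8`: `–, –, 3.9e-5,
  1.2e-4, 3.9e-5`; `κ = 11`: `–, –, –, 3.1e-6, 5.9e-7`; the enstrophy shell spectra COINCIDE across `N` to 2–3 digits and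
  decay exponentially past `k_η` (`N = 21`: shells 12…21 carry `5.8e-5 … 3e-11` of `Z ≈ 374`). No pile-up at the
  truncation shell: the time-average measures are `κ`-resolved UNIFORMLY IN `N`, as `IsResolved`/`ResolvedDissipation` posit.
* (A) DIAGONAL `ν = 0.04, 0.02, 0.01, 0.005` (`N = 11, 16, 21, 21`; `N/k_η = 3.7, 3.2, 2.4, 1.4` — the last marginal):
  `E = 2.00, 4.24, 5.12, 6.19` (bounded, slowly saturating); `ε = 8.16, 7.58, 8.67, 9.49` — `O(1)`, NOT decreasing over a
  factor 8 in `ν`; `U1 = 1.03, 0.96, 1.11, 1.21` vs laminar `2.5, 5, 10, 20`; drag coefficient `F0/(2πk_f U1²) = 1.18, 1.36,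
  1.02, 0.86`; `ε = (f, ū) = F0·U1/2` to 1 %. I.e. exactly the mean-flow floor of §F realised with `O(1)` constants: loud at
  bounded energy through an `O(1)` mean flow correlated with the force — the Galerkin-ensemble zeroth law at these (low,
  `Re_λ ≈ 5–37`) Reynolds numbers. A kill-relevant signal (`ε → 0` or `U1 → 0` at bounded `E`, or an `N`-growing tail) is ABSENT.
* Smoke runs: j014656 (`k_f = 2`, `ν = 0.04`, `N = 6`: non-laminar, balanced); j014644 (gravest-mode forcing `k_f = 1`,
  `ν = 0.04`: relaxes to the laminar state, `U1 → 6.25 =` laminar — the subcritical 3-D Kolmogorov regime of van Veen–Goto,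
  consistent with `Literature/Barriers/AnomalousDissipation/GravestModeLaminarAttractor`'s scope caveat).

## Targets (lead's stuck stubs): none posted (payload.targets = [], no line picked yet).
-/

namespace Summit.AnomalousDissipation.AnomalousDissipation.Cruxes.MomentLadder.Disproof

open MeasureTheory Filter Topology
open scoped ENNReal InnerProductSpace RealInnerProductSpace
open Literature.Analysis.FunctionSpaces Literature.Analysis.FluidPDE
open Summit.AnomalousDissipation.AnomalousDissipation.Theses.MomentParity
open Summit.AnomalousDissipation.AnomalousDissipation.Theorems.QuarticGate.Negative

set_option linter.dupNamespace false

noncomputable section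

/-! ## Vocabulary (verbatim clauses of `MomentLadder`, named; `IsLevel`, `IsBandTest`, `polyGrad`,
`IsPolyStationary` are the landed ones of `Theorems/QuarticGate/Negative/LevelCeiling.lean`) -/

/-- Support clause of `MomentLadder`: `‖u‖ ≤ R` for `μ`-a.e. `u` (verbatim). -/
def IsSupported (R : ℝ) (μ : Measure (Torus.energySpace (Fin 3))) : Prop :=
  ∀ᵐ u ∂μ, ‖u‖ ≤ R

/-- Resolution clause of `MomentLadder` (verbatim): the mean enstrophy is carried by the modes
`|k| ≤ κ n` up to `1/(n+1)`, for every `n`. -/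
def IsResolved (κ : ℕ → ℕ) (μ : Measure (Torus.energySpace (Fin 3))) : Prop :=
  ∀ n : ℕ, ∫⁻ (u : Torus.energySpace (Fin 3)),
      Torus.eGradNormSq (u.1 : UnitAddTorus (Fin 3) → EuclideanSpace ℝ (Fin 3)) ∂μ ≤
    (∫⁻ (u : Torus.energySpace (Fin 3)),
      Torus.eGradNormSq (Torus.fourierTruncate (κ n)
        (u.1 : UnitAddTorus (Fin 3) → EuclideanSpace ℝ (Fin 3))) ∂μ) + ((n : ENNReal) + 1)⁻¹

/-- The level-`N`, order-`d` witness clauses of `MomentLadder` at viscosity `ν`, budgets `E`, `ε`,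
support radius `R` and resolution schedule `κ` (verbatim body of the crux after `∃ μ`). -/
def IsLadderWitness (f : UnitAddTorus (Fin 3) → EuclideanSpace ℝ (Fin 3)) (ν : ℝ) (N : ℕ)
    (E ε R : ℝ) (κ : ℕ → ℕ) (d : ℕ) (μ : Measure (Torus.energySpace (Fin 3))) : Prop :=
  IsProbabilityMeasure μ ∧ (∀ᵐ u ∂μ, IsLevel N u) ∧ IsSupported R μ ∧ IsResolved κ μ ∧
    IsPolyStationary ν f N d μ ∧ Torus.ensembleEnergy μ ≤ E ∧ ε ≤ Torus.ensembleDissipation ν μ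

/-- `MomentLadder` restated through the vocabulary (definitional unfolding, `Iff.rfl`). -/
theorem momentLadder_iff :
    MomentLadder ↔ ∃ f : UnitAddTorus (Fin 3) → EuclideanSpace ℝ (Fin 3),
      Torus.IsSmooth f ∧ Torus.IsDivFree f ∧ Torus.HasZeroMean f ∧
      ∃ (ν : ℕ → ℝ) (E ε : ℝ), (∀ j, 0 < ν j) ∧ Tendsto ν atTop (𝓝 0) ∧ 0 < ε ∧
      ∀ j : ℕ, ∃ (R : ℝ) (κ : ℕ → ℕ), ∃ᶠ N in atTop, ∀ d : ℕ, ∃ μ,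
        IsLadderWitness f (ν j) N E ε R κ d μ :=
  Iff.rfl

/-! ## 0. Bounded support gives all moments; the `d = 4` rung is a `QuarticGate` witness -/

section Transfer

/-- On a finite measure, an a.e. norm bound gives every moment. [folklore] -/
theorem integrable_norm_pow_of_isSupported {μ : Measure (Torus.energySpace (Fin 3))}
    [IsFiniteMeasure μ] {R : ℝ} (hR : IsSupported R μ) (p : ℕ) :
    Integrable (fun u : Torus.energySpace (Fin 3) => ‖u‖ ^ p) μ := by
  refine Integrable.mono' (integrable_const ((max R 0) ^ p))
    (continuous_norm.pow p).aestronglyMeasurable (hR.mono fun u hu => ?_)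
  rw [Real.norm_eq_abs, abs_of_nonneg (by positivity)]
  exact pow_le_pow_left₀ (norm_nonneg _) (hu.trans (le_max_left _ _)) p

/-- A ladder witness of order `d ≥ 4` is a `QuarticGate` witness (the fourth moment comes from the
support clause). [folklore] -/
theorem IsLadderWitness.isQuarticWitness {f : UnitAddTorus (Fin 3) → EuclideanSpace ℝ (Fin 3)}
    {ν : ℝ} {N : ℕ} {E ε R : ℝ} {κ : ℕ → ℕ} {d : ℕ} {μ : Measure (Torus.energySpace (Fin 3))}
    (h : IsLadderWitness f ν N E ε R κ d μ) (hd : 4 ≤ d) : IsQuarticWitness f ν N E ε μ := by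
  obtain ⟨hprob, hlev, hsupp, -, hstat, hE, hε⟩ := h
  exact ⟨hprob, hlev, integrable_norm_pow_of_isSupported hsupp 4, hstat.mono hd, hE, hε⟩

/-- **`MomentLadder → QuarticGate`** (the `d = 4` rung minus support/resolution): every negative
result on `QuarticGate` transfers. Stated negatively for the Negative lane: -/
theorem not_momentLadder_of_not_quarticGate (h : ¬ QuarticGate) : ¬ MomentLadder := by
  intro hL
  obtain ⟨f, hfs, hfd, hfz, ν, E, ε, hν, hν0, hε, hj⟩ := momentLadder_iff.1 hL
  refine h (quarticGate_iff.2 ⟨f, hfs, hfd, hfz, ν, E, ε, hν, hν0, hε, fun j => ?_⟩)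
  obtain ⟨R, κ, hfreq⟩ := hj j
  exact hfreq.mono fun N hN => by
    obtain ⟨μ, hμ⟩ := hN 4
    exact ⟨μ, hμ.isQuarticWitness le_rfl⟩

end Transfer

/-! ## A. Level ceiling: `ε ≤ 4π²N²ν_jE`; the level cannot be chosen before `j` -/

section Ceiling

/-- **Quantitative level ceiling for ladder witnesses** (any order `d`, stationarity unused):
`ε ≤ 4π² N² ν E`. [folklore] -/
theorem IsLadderWitness.eps_le_level {f : UnitAddTorus (Fin 3) → EuclideanSpace ℝ (Fin 3)}
    {ν : ℝ} (hν : 0 ≤ ν) {N : ℕ} {E ε R : ℝ} {κ : ℕ → ℕ} {d : ℕ}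
    {μ : Measure (Torus.energySpace (Fin 3))} (h : IsLadderWitness f ν N E ε R κ d μ) :
    ε ≤ 4 * Real.pi ^ 2 * (N : ℝ) ^ 2 * ν * E := by
  obtain ⟨hprob, hlev, hsupp, -, -, hEn, hε⟩ := h
  have hdiss := ensembleDissipation_le_of_level hν hlev (integrable_norm_pow_of_isSupported hsupp 2)
  have hE0 : 0 ≤ Torus.ensembleEnergy μ := integral_nonneg fun u => by positivity
  calc ε ≤ Torus.ensembleDissipation ν μ := hε
    _ ≤ 4 * Real.pi ^ 2 * (N : ℝ) ^ 2 * ν * Torus.ensembleEnergy μ := hdiss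
    _ ≤ 4 * Real.pi ^ 2 * (N : ℝ) ^ 2 * ν * E := by gcongr

/-- At level `N = 0` there is no witness with `ε > 0` (the punctured ball is empty, every level-0
field is `0`, the dissipation vanishes). [folklore] -/
theorem not_isLadderWitness_level_zero {f : UnitAddTorus (Fin 3) → EuclideanSpace ℝ (Fin 3)}
    {ν : ℝ} (hν : 0 ≤ ν) {E ε R : ℝ} (hε : 0 < ε) {κ : ℕ → ℕ} {d : ℕ}
    {μ : Measure (Torus.energySpace (Fin 3))} : ¬ IsLadderWitness f ν 0 E ε R κ d μ := fun h => by
  have := h.eps_le_level hν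
  simp at this
  linarith

/-- NATURAL STRENGTHENING 1 (refuted): `MomentLadder` with the Galerkin level `N` chosen BEFORE the
viscosity index `j` (even only frequently in `j`, any support/resolution data). -/
def MomentLadderBoundedLevel : Prop :=
  ∃ f : UnitAddTorus (Fin 3) → EuclideanSpace ℝ (Fin 3),
    Torus.IsSmooth f ∧ Torus.IsDivFree f ∧ Torus.HasZeroMean f ∧
    ∃ (ν : ℕ → ℝ) (E ε : ℝ), (∀ j, 0 < ν j) ∧ Tendsto ν atTop (𝓝 0) ∧ 0 < ε ∧
    ∃ N : ℕ, ∃ᶠ j in atTop, ∃ (R : ℝ) (κ : ℕ → ℕ), ∀ d : ℕ, ∃ μ,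
      IsLadderWitness f (ν j) N E ε R κ d μ

/-- **`¬ MomentLadderBoundedLevel`**: a level-`N` ensemble of energy `≤ E` dissipates
`≤ 4π²N²ν_jE → 0`. Every proof of `MomentLadder` must let `N → ∞` at least like `ν_j^{-1/2}`
inside its `∃ᶠ N`. [folklore] -/
theorem not_momentLadderBoundedLevel : ¬ MomentLadderBoundedLevel := by
  rintro ⟨f, -, -, -, ν, E, ε, hν, hν0, hε, N, hfreq⟩
  obtain ⟨j, ⟨R, κ, hd⟩, hno⟩ :=
    (hfreq.and_eventually (eventually_not_isQuarticWitness f hν hν0 E hε N)).exists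
  obtain ⟨μ, hμ⟩ := hd 4
  exact hno μ (hμ.isQuarticWitness le_rfl)

end Ceiling

/-! ## B. Resolution floor: `ε ≤ ν_j (4π² κ_j(n)² E + 1/(n+1))`; the schedule cannot be uniform in `j` -/

section Resolution

/-- **Bernstein for the truncation** (spectral form, any `L²` class): `‖∇P_K v‖₂² ≤ 4π²K² ‖v‖₂²`
in `ℝ≥0∞`. [folklore] -/
theorem eGradNormSq_fourierTruncate_le_sq_mul (K : ℕ)
    (v : Lp (EuclideanSpace ℝ (Fin 3)) 2 (volume : Measure (UnitAddTorus (Fin 3)))) :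
    Torus.eGradNormSq (Torus.fourierTruncate K (v : UnitAddTorus (Fin 3) → EuclideanSpace ℝ (Fin 3))) ≤
      ENNReal.ofReal (4 * Real.pi ^ 2 * (K : ℝ) ^ 2) * ‖v‖ₑ ^ 2 := by
  have hint : Integrable (v : UnitAddTorus (Fin 3) → EuclideanSpace ℝ (Fin 3)) volume :=
    (Lp.memLp v).integrable one_le_two
  rw [Torus.eGradNormSq_eq_tsum, Torus.enorm_sq_coe_eq_tsum, ← ENNReal.tsum_mul_left,
    ← ENNReal.tsum_mul_left]
  refine ENNReal.tsum_le_tsum fun k => ?_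
  rw [Torus.mFourierCoeff_fourierTruncate hint]
  by_cases hk : k ∈ Torus.freqBall K
  · rw [if_pos hk]
    have hkK : Torus.freqNormSq k ≤ (K : ℝ) ^ 2 := Torus.mem_freqBall.1 hk
    rw [← mul_assoc, ← ENNReal.ofReal_mul (by positivity)]
    gcongr
  · rw [if_neg hk]
    simp

/-- The mean enstrophy of the truncation is bounded by `4π²K²` times the mean energy. [folklore] -/
theorem lintegral_eGradNormSq_fourierTruncate_le (K : ℕ) (μ : Measure (Torus.energySpace (Fin 3))) :
    ∫⁻ (u : Torus.energySpace (Fin 3)),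
        Torus.eGradNormSq (Torus.fourierTruncate K
          (u.1 : UnitAddTorus (Fin 3) → EuclideanSpace ℝ (Fin 3))) ∂μ ≤
      ENNReal.ofReal (4 * Real.pi ^ 2 * (K : ℝ) ^ 2) * ∫⁻ u, ‖u‖ₑ ^ 2 ∂μ := by
  rw [← lintegral_const_mul' _ _ ENNReal.ofReal_ne_top]
  exact lintegral_mono fun u => eGradNormSq_fourierTruncate_le_sq_mul K u.1

/-- **Resolution floor, `ℝ≥0∞` form**: a `κ`-resolved law has
`∫‖∇u‖² dμ ≤ 4π² κ(n)² ∫|u|² dμ + 1/(n+1)` for every `n`. [folklore] -/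
theorem IsResolved.ensembleEnstrophy_le {κ : ℕ → ℕ} {μ : Measure (Torus.energySpace (Fin 3))}
    (h : IsResolved κ μ) (n : ℕ) :
    Torus.ensembleEnstrophy μ ≤
      ENNReal.ofReal (4 * Real.pi ^ 2 * (κ n : ℝ) ^ 2) * (∫⁻ u, ‖u‖ₑ ^ 2 ∂μ) + ((n : ℝ≥0∞) + 1)⁻¹ :=
  (h n).trans (add_le_add (lintegral_eGradNormSq_fourierTruncate_le (κ n) μ) le_rfl)

/-- **Resolution floor for the dissipation**: a `κ`-resolved law with integrable energy has
`ensembleDissipation ν μ ≤ ν (4π² κ(n)² ensembleEnergy μ + 1/(n+1))` for every `n` (`0 ≤ ν`).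
Level and stationarity are NOT used. [folklore] -/
theorem ensembleDissipation_le_of_isResolved {ν : ℝ} (hν : 0 ≤ ν) {κ : ℕ → ℕ}
    {μ : Measure (Torus.energySpace (Fin 3))} (h : IsResolved κ μ)
    (hE : Integrable (fun u : Torus.energySpace (Fin 3) => ‖u‖ ^ 2) μ) (n : ℕ) :
    Torus.ensembleDissipation ν μ ≤
      ν * (4 * Real.pi ^ 2 * (κ n : ℝ) ^ 2 * Torus.ensembleEnergy μ + ((n : ℝ) + 1)⁻¹) := by
  have h1 := h.ensembleEnstrophy_le n
  have h2 : ∫⁻ u, ‖u‖ₑ ^ 2 ∂μ = ENNReal.ofReal (Torus.ensembleEnergy μ) := by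
    rw [Torus.ensembleEnergy, ofReal_integral_eq_lintegral_ofReal hE
      (ae_of_all _ fun u => by positivity)]
    refine lintegral_congr fun u => ?_
    rw [← ofReal_norm, ← ENNReal.ofReal_pow (norm_nonneg _)]
  have h3 : ((n : ℝ≥0∞) + 1)⁻¹ = ENNReal.ofReal (((n : ℝ) + 1)⁻¹) := by
    rw [ENNReal.ofReal_inv_of_pos (by positivity), ENNReal.ofReal_add (by positivity) zero_le_one,
      ENNReal.ofReal_natCast, ENNReal.ofReal_one]
  have hE0 : 0 ≤ Torus.ensembleEnergy μ := integral_nonneg fun u => by positivity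
  rw [h2, h3, ← ENNReal.ofReal_mul (by positivity), ← ENNReal.ofReal_add (by positivity) (by positivity)]
    at h1
  have h4 : (Torus.ensembleEnstrophy μ).toReal ≤
      4 * Real.pi ^ 2 * (κ n : ℝ) ^ 2 * Torus.ensembleEnergy μ + ((n : ℝ) + 1)⁻¹ := by
    have := ENNReal.toReal_mono ENNReal.ofReal_ne_top h1
    rwa [ENNReal.toReal_ofReal (by positivity)] at this
  unfold Torus.ensembleDissipation
  exact mul_le_mul_of_nonneg_left h4 hν

/-- **Quantitative resolution floor for ladder witnesses** (any order `d`; level and stationarity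
unused): `ε ≤ ν (4π² κ(n)² E + 1/(n+1))` for every `n`. Read with `n = 0`: a witness at viscosity
`ν_j` needs `κ_j(0)² ≥ (ε/ν_j − 1)/(4π²E)` — the resolution schedule must degrade at least like
`κ_j ≳ ν_j^{-1/2}` (the Taylor wavenumber), exactly as the level must (`§A`). [folklore] -/
theorem IsLadderWitness.eps_le_resolution {f : UnitAddTorus (Fin 3) → EuclideanSpace ℝ (Fin 3)}
    {ν : ℝ} (hν : 0 ≤ ν) {N : ℕ} {E ε R : ℝ} {κ : ℕ → ℕ} {d : ℕ}
    {μ : Measure (Torus.energySpace (Fin 3))} (h : IsLadderWitness f ν N E ε R κ d μ) (n : ℕ) :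
    ε ≤ ν * (4 * Real.pi ^ 2 * (κ n : ℝ) ^ 2 * E + ((n : ℝ) + 1)⁻¹) := by
  obtain ⟨hprob, -, hsupp, hres, -, hEn, hε⟩ := h
  have hdiss := ensembleDissipation_le_of_isResolved hν hres (integrable_norm_pow_of_isSupported hsupp 2) n
  calc ε ≤ Torus.ensembleDissipation ν μ := hε
    _ ≤ ν * (4 * Real.pi ^ 2 * (κ n : ℝ) ^ 2 * Torus.ensembleEnergy μ + ((n : ℝ) + 1)⁻¹) := hdiss
    _ ≤ ν * (4 * Real.pi ^ 2 * (κ n : ℝ) ^ 2 * E + ((n : ℝ) + 1)⁻¹) := by gcongr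

/-- The same floor solved for the schedule: `ε/ν − 1/(n+1) ≤ 4π² κ(n)² E` (`0 < ν`). [folklore] -/
theorem IsLadderWitness.resolution_floor {f : UnitAddTorus (Fin 3) → EuclideanSpace ℝ (Fin 3)}
    {ν : ℝ} (hν : 0 < ν) {N : ℕ} {E ε R : ℝ} {κ : ℕ → ℕ} {d : ℕ}
    {μ : Measure (Torus.energySpace (Fin 3))} (h : IsLadderWitness f ν N E ε R κ d μ) (n : ℕ) :
    ε / ν - ((n : ℝ) + 1)⁻¹ ≤ 4 * Real.pi ^ 2 * (κ n : ℝ) ^ 2 * E := by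
  have h1 := h.eps_le_resolution hν.le n
  rw [sub_le_iff_le_add, div_le_iff₀ hν]
  linarith

/-- With a FIXED schedule `κ`, witnesses exist for only finitely many `j` along any `ν_j → 0`
(any level, any radius, any order). [folklore] -/
theorem eventually_not_isLadderWitness_of_schedule (f : UnitAddTorus (Fin 3) → EuclideanSpace ℝ (Fin 3))
    {ν : ℕ → ℝ} (hν : ∀ j, 0 < ν j) (hν0 : Tendsto ν atTop (𝓝 0)) (E : ℝ) {ε : ℝ} (hε : 0 < ε)
    (κ : ℕ → ℕ) :
    ∀ᶠ j in atTop, ∀ N R d μ, ¬ IsLadderWitness f (ν j) N E ε R κ d μ := by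
  set C : ℝ := 4 * Real.pi ^ 2 * (κ 0 : ℝ) ^ 2 * max E 0 + 1 + 1 with hC
  have hCpos : 0 < C := by positivity
  have hev : ∀ᶠ j in atTop, ν j < ε / C := (tendsto_order.1 hν0).2 _ (div_pos hε hCpos)
  refine hev.mono fun j hj N R d μ hw => ?_
  have h1 := hw.eps_le_resolution (hν j).le 0
  simp only [Nat.cast_zero, zero_add, inv_one] at h1
  have hmax : 4 * Real.pi ^ 2 * (κ 0 : ℝ) ^ 2 * E ≤ 4 * Real.pi ^ 2 * (κ 0 : ℝ) ^ 2 * max E 0 :=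
    mul_le_mul_of_nonneg_left (le_max_left E 0) (by positivity)
  have h2 : ν j * (4 * Real.pi ^ 2 * (κ 0 : ℝ) ^ 2 * E + 1) ≤ ν j * (C - 1) :=
    mul_le_mul_of_nonneg_left (by rw [hC]; linarith) (hν j).le
  have h3 : ν j * (C - 1) < ε := by
    have := (lt_div_iff₀ hCpos).1 hj
    nlinarith [(hν j).le]
  linarith

/-- NATURAL STRENGTHENING 2 (refuted): `MomentLadder` with the resolution schedule `κ` chosen
BEFORE the viscosity index `j` (uniform-in-`ν` resolution of the dissipation). -/
def MomentLadderUniformResolution : Prop :=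
  ∃ f : UnitAddTorus (Fin 3) → EuclideanSpace ℝ (Fin 3),
    Torus.IsSmooth f ∧ Torus.IsDivFree f ∧ Torus.HasZeroMean f ∧
    ∃ (ν : ℕ → ℝ) (E ε : ℝ), (∀ j, 0 < ν j) ∧ Tendsto ν atTop (𝓝 0) ∧ 0 < ε ∧
    ∃ κ : ℕ → ℕ, ∀ j : ℕ, ∃ R : ℝ, ∃ᶠ N in atTop, ∀ d : ℕ, ∃ μ,
      IsLadderWitness f (ν j) N E ε R κ d μ

/-- **`¬ MomentLadderUniformResolution`**: a law whose enstrophy sits below `κ(0)` up to `1` has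
dissipation `≤ ν_j(4π²κ(0)²E + 1) → 0`. So in `MomentLadder` the order "`∀ j ∃ κ`" is essential: the
dissipation range of any witnessing family moves to infinity as `ν_j → 0` (at least like
`ν_j^{-1/2}`), and the resolution clause only asks that it does so UNIFORMLY IN THE LEVEL `N` at each
fixed `j` — which is the content of the sibling crux `ResolvedDissipation`, not a `ν`-uniform bound.
[folklore] -/
theorem not_momentLadderUniformResolution : ¬ MomentLadderUniformResolution := by
  rintro ⟨f, -, -, -, ν, E, ε, hν, hν0, hε, κ, hj⟩
  obtain ⟨j, hjno⟩ := (eventually_not_isLadderWitness_of_schedule f hν hν0 E hε κ).exists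
  obtain ⟨R, hfreq⟩ := hj j
  obtain ⟨N, hN⟩ := hfreq.exists
  obtain ⟨μ, hμ⟩ := hN 0
  exact hjno N R 0 μ hμ

/-- The truncation enstrophy is monotone in the cutoff. [folklore] -/
theorem eGradNormSq_fourierTruncate_mono {K K' : ℕ} (hK : K ≤ K')
    (v : Lp (EuclideanSpace ℝ (Fin 3)) 2 (volume : Measure (UnitAddTorus (Fin 3)))) :
    Torus.eGradNormSq (Torus.fourierTruncate K (v : UnitAddTorus (Fin 3) → EuclideanSpace ℝ (Fin 3))) ≤
      Torus.eGradNormSq (Torus.fourierTruncate K' (v : UnitAddTorus (Fin 3) → EuclideanSpace ℝ (Fin 3))) := by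
  have hint : Integrable (v : UnitAddTorus (Fin 3) → EuclideanSpace ℝ (Fin 3)) volume :=
    (Lp.memLp v).integrable one_le_two
  rw [Torus.eGradNormSq_eq_tsum, Torus.eGradNormSq_eq_tsum]
  refine mul_le_mul' le_rfl (ENNReal.tsum_le_tsum fun k => ?_)
  rw [Torus.mFourierCoeff_fourierTruncate hint, Torus.mFourierCoeff_fourierTruncate hint]
  by_cases hk : k ∈ Torus.freqBall K
  · rw [if_pos hk, if_pos (Torus.freqBall_mono hK hk)]
  · rw [if_neg hk]
    simp

/-- `IsResolved` is monotone in the schedule: a finer cutoff resolves at least as much. So a prover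
may always enlarge `κ` (e.g. make it increasing, or dominate finitely many schedules). [folklore] -/
theorem IsResolved.mono {κ κ' : ℕ → ℕ} (hκ : ∀ n, κ n ≤ κ' n) {μ : Measure (Torus.energySpace (Fin 3))}
    (h : IsResolved κ μ) : IsResolved κ' μ := fun n =>
  (h n).trans (add_le_add (lintegral_mono fun u => eGradNormSq_fourierTruncate_mono (hκ n) u.1) le_rfl)

/-- `IsSupported` is monotone in the radius. [folklore] -/
theorem IsSupported.mono {R R' : ℝ} (hR : R ≤ R') {μ : Measure (Torus.energySpace (Fin 3))}
    (h : IsSupported R μ) : IsSupported R' μ :=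
  Filter.Eventually.mono h fun _ hu => hu.trans hR

/-- A ladder witness of order `d` is one of every lower order. [folklore] -/
theorem IsLadderWitness.mono_d {f : UnitAddTorus (Fin 3) → EuclideanSpace ℝ (Fin 3)} {ν : ℝ} {N : ℕ}
    {E ε R : ℝ} {κ : ℕ → ℕ} {d d' : ℕ} {μ : Measure (Torus.energySpace (Fin 3))}
    (h : IsLadderWitness f ν N E ε R κ d' μ) (hd : d ≤ d') : IsLadderWitness f ν N E ε R κ d μ := by
  obtain ⟨h1, h2, h3, h4, h5, h6, h7⟩ := h
  exact ⟨h1, h2, h3, h4, h5.mono hd, h6, h7⟩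

end Resolution

/-! ## C. Energy row (order `d ≥ 3`): dissipation = injection; force floor, radius floor -/

section EnergyRow

/-- **Dissipation = mean injection** for a ladder witness of order `d ≥ 3` with an `L²` force:
`ensembleDissipation ν μ = ∫ (u, f) dμ` (the quadratic frame test, landed sibling energy row). [folklore] -/
theorem IsLadderWitness.dissipation_eq {f : UnitAddTorus (Fin 3) → EuclideanSpace ℝ (Fin 3)}
    (hf : MemLp f 2 volume) {ν : ℝ} {N : ℕ} {E ε R : ℝ} {κ : ℕ → ℕ} {d : ℕ}
    {μ : Measure (Torus.energySpace (Fin 3))} (h : IsLadderWitness f ν N E ε R κ d μ) (hd : 3 ≤ d) :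
    Torus.ensembleDissipation ν μ = ∫ u, Torus.pairing u.1 f ∂μ := by
  obtain ⟨hprob, hlev, hsupp, -, hstat, -, -⟩ := h
  exact ensembleDissipation_eq_of_polyStationary f hf hlev (integrable_norm_pow_of_isSupported hsupp 2)
    hd hstat

/-- **FORCE FLOOR**: `ε ≤ ‖f‖_{L²} √E` for every ladder witness of order `d ≥ 3`. [folklore] -/
theorem IsLadderWitness.eps_le_force {f : UnitAddTorus (Fin 3) → EuclideanSpace ℝ (Fin 3)}
    (hf : MemLp f 2 volume) {ν : ℝ} {N : ℕ} {E ε R : ℝ} {κ : ℕ → ℕ} {d : ℕ}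
    {μ : Measure (Torus.energySpace (Fin 3))} (h : IsLadderWitness f ν N E ε R κ d μ) (hd : 3 ≤ d) :
    ε ≤ Real.sqrt (∫ x, ‖f x‖ ^ 2) * Real.sqrt E := by
  obtain ⟨hprob, hlev, hsupp, -, hstat, hEn, hε⟩ := h
  calc ε ≤ Torus.ensembleDissipation ν μ := hε
    _ ≤ Real.sqrt (∫ x, ‖f x‖ ^ 2) * Real.sqrt (Torus.ensembleEnergy μ) :=
        ensembleDissipation_le_of_polyStationary f hf hlev (integrable_norm_pow_of_isSupported hsupp 2)
          hd hstat
    _ ≤ Real.sqrt (∫ x, ‖f x‖ ^ 2) * Real.sqrt E := by gcongr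

/-- **RADIUS FLOOR**: `ε ≤ ‖f‖_{L²} R` for every ladder witness of order `d ≥ 3` — the support radius
of a witnessing family cannot shrink below `ε/‖f‖₂` (uniformly in `j`). [folklore] -/
theorem IsLadderWitness.eps_le_force_mul_radius {f : UnitAddTorus (Fin 3) → EuclideanSpace ℝ (Fin 3)}
    (hf : MemLp f 2 volume) {ν : ℝ} {N : ℕ} {E ε R : ℝ} {κ : ℕ → ℕ} {d : ℕ}
    {μ : Measure (Torus.energySpace (Fin 3))} (h : IsLadderWitness f ν N E ε R κ d μ) (hd : 3 ≤ d) :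
    ε ≤ Real.sqrt (∫ x, ‖f x‖ ^ 2) * R := by
  have hdiss := h.dissipation_eq hf hd
  obtain ⟨hprob, hlev, hsupp, -, hstat, hEn, hε⟩ := h
  have h1 : Integrable (fun u : Torus.energySpace (Fin 3) => ‖u‖) μ := by
    simpa using integrable_norm_pow_of_isSupported hsupp 1
  have hle : ∫ u, Torus.pairing u.1 f ∂μ ≤ ∫ _u, ‖hf.toLp f‖ * R ∂μ :=
    integral_mono_ae
      (Summit.AnomalousDissipation.AnomalousDissipation.Theorems.CubicParityLoud.Negative.integrable_pairing
        hf h1) (integrable_const _)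
      (Filter.Eventually.mono hsupp fun u hu => (le_abs_self _).trans
        ((Torus.abs_pairing_coe_le hf u).trans (by
          rw [mul_comm]; exact mul_le_mul_of_nonneg_left hu (norm_nonneg _))))
  have hconst : ∫ _u, ‖hf.toLp f‖ * R ∂μ = ‖hf.toLp f‖ * R := by simp
  rw [hconst, Torus.norm_toLp_eq_sqrt hf] at hle
  linarith [hdiss ▸ hε]

/-- A witness force is not `0` (in `L²`): at order `d ≥ 3`, `f = 0` a.e. forces `ε ≤ 0`. [folklore] -/
theorem IsLadderWitness.force_not_ae_zero {f : UnitAddTorus (Fin 3) → EuclideanSpace ℝ (Fin 3)}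
    (hf : MemLp f 2 volume) {ν : ℝ} {N : ℕ} {E ε R : ℝ} (hε : 0 < ε) {κ : ℕ → ℕ} {d : ℕ}
    {μ : Measure (Torus.energySpace (Fin 3))} (h : IsLadderWitness f ν N E ε R κ d μ) (hd : 3 ≤ d) :
    ¬ (f =ᵐ[volume] 0) := fun h0 => by
  have h1 := h.eps_le_force hf hd
  have h2 : ∫ x, ‖f x‖ ^ 2 = 0 := by
    rw [integral_congr_ae (g := fun _ => (0 : ℝ)) (h0.mono fun x hx => by simp [hx])]
    simp
  rw [h2, Real.sqrt_zero, zero_mul] at h1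
  linarith

/-- NATURAL STRENGTHENING 3 (refuted): `MomentLadder` for EVERY admissible force. -/
def MomentLadderEveryForce : Prop :=
  ∀ f : UnitAddTorus (Fin 3) → EuclideanSpace ℝ (Fin 3),
    Torus.IsSmooth f → Torus.IsDivFree f → Torus.HasZeroMean f →
    ∃ (ν : ℕ → ℝ) (E ε : ℝ), (∀ j, 0 < ν j) ∧ Tendsto ν atTop (𝓝 0) ∧ 0 < ε ∧
    ∀ j : ℕ, ∃ (R : ℝ) (κ : ℕ → ℕ), ∃ᶠ N in atTop, ∀ d : ℕ, ∃ μ,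
      IsLadderWitness f (ν j) N E ε R κ d μ

/-- **`¬ MomentLadderEveryForce`**: the zero force is quiet at every order (`ε ≤ ‖0‖₂ √E = 0`).
The `∃ f` of the crux is load-bearing; a witness force has `‖f‖_{L²} ≥ ε/√E` and `≥ ε/R`. [folklore] -/
theorem not_momentLadderEveryForce : ¬ MomentLadderEveryForce := by
  intro h
  have hzero : (Torus.realTrigPoly (∅ : Finset (Fin 3 → ℤ)) (0 : (Fin 3 → ℤ) → EuclideanSpace ℂ (Fin 3)))
      = fun _ => 0 := Torus.realTrigPoly_zero ∅
  obtain ⟨ν, E, ε, hν, -, hε, hj⟩ := h (fun _ => 0) (Torus.isSmooth_const _)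
    (by rw [← hzero]; exact Torus.isDivFree_realTrigPoly fun k hk => by simp at hk)
    (by simp [Torus.HasZeroMean])
  obtain ⟨R, κ, hfreq⟩ := hj 0
  obtain ⟨N, hN⟩ := hfreq.exists
  obtain ⟨μ, hμ⟩ := hN 3
  have := hμ.eps_le_force (memLp_const 0) le_rfl
  simp at this
  linarith

/-- NATURAL STRENGTHENING 4 (refuted): `MomentLadder` with an energy budget below the force floor,
`‖f‖_{L²} √E < ε`. -/
def MomentLadderSubFloor : Prop :=
  ∃ f : UnitAddTorus (Fin 3) → EuclideanSpace ℝ (Fin 3),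
    Torus.IsSmooth f ∧ Torus.IsDivFree f ∧ Torus.HasZeroMean f ∧
    ∃ (ν : ℕ → ℝ) (E ε : ℝ), (∀ j, 0 < ν j) ∧ Tendsto ν atTop (𝓝 0) ∧ 0 < ε ∧
    Real.sqrt (∫ x, ‖f x‖ ^ 2) * Real.sqrt E < ε ∧
    ∀ j : ℕ, ∃ (R : ℝ) (κ : ℕ → ℕ), ∃ᶠ N in atTop, ∀ d : ℕ, ∃ μ,
      IsLadderWitness f (ν j) N E ε R κ d μ

/-- **`¬ MomentLadderSubFloor`**: `ε ≤ ‖f‖_{L²}√E` for every witness of order `≥ 3`; TIGHT (the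
laminar Kolmogorov Dirac of `Negative/Laminar.lean` attains it). Provers: `E ≥ (ε/‖f‖₂)²`. [folklore] -/
theorem not_momentLadderSubFloor : ¬ MomentLadderSubFloor := by
  rintro ⟨f, hfs, -, -, ν, E, ε, hν, -, hε, hlt, hj⟩
  obtain ⟨R, κ, hfreq⟩ := hj 0
  obtain ⟨N, hN⟩ := hfreq.exists
  obtain ⟨μ, hμ⟩ := hN 3
  have := hμ.eps_le_force (hfs.memLp 2) le_rfl
  linarith

end EnergyRow

/-! ## D. Load-bearing clauses: the weakenings that hold trivially -/

section LoadBearing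

/-- The spectral enstrophy of the representative of `0 ∈ H` vanishes. [folklore] -/
theorem eGradNormSq_coe_zero :
    Torus.eGradNormSq (((0 : Torus.energySpace (Fin 3)).1 :
      Lp (EuclideanSpace ℝ (Fin 3)) 2 (volume : Measure (UnitAddTorus (Fin 3)))) :
        UnitAddTorus (Fin 3) → EuclideanSpace ℝ (Fin 3)) = 0 := by
  rw [Torus.eGradNormSq_eq_tsum]
  simp_rw [mFourierCoeff_coe_zero]
  simp

/-- `δ₀` is resolved by every schedule. [folklore] -/
theorem isResolved_dirac_zero (κ : ℕ → ℕ) :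
    IsResolved κ (Measure.dirac (0 : Torus.energySpace (Fin 3))) := by
  haveI : MeasurableSingletonClass (Torus.energySpace (Fin 3)) :=
    OpensMeasurableSpace.toMeasurableSingletonClass
  intro n
  rw [lintegral_dirac, eGradNormSq_coe_zero]
  exact zero_le

/-- The truncation at a cutoff above the level does not change the spectral enstrophy. [folklore] -/
theorem eGradNormSq_fourierTruncate_of_isLevel {K M : ℕ} {U : Torus.energySpace (Fin 3)}
    (hU : IsLevel K U) (hKM : K ≤ M) :
    Torus.eGradNormSq (Torus.fourierTruncate M (U.1 : UnitAddTorus (Fin 3) → EuclideanSpace ℝ (Fin 3))) =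
      Torus.eGradNormSq (U.1 : UnitAddTorus (Fin 3) → EuclideanSpace ℝ (Fin 3)) := by
  have hint : Integrable (U.1 : UnitAddTorus (Fin 3) → EuclideanSpace ℝ (Fin 3)) volume :=
    (Lp.memLp U.1).integrable one_le_two
  rw [Torus.eGradNormSq_eq_tsum, Torus.eGradNormSq_eq_tsum]
  congr 1
  refine tsum_congr fun k => ?_
  rw [Torus.mFourierCoeff_fourierTruncate hint]
  split_ifs with hk
  · rfl
  · rw [hU k fun hk' => hk (Torus.freqBall_mono hKM (Finset.mem_of_mem_erase hk'))]

/-- A Dirac mass at a level-`K` state is resolved by every schedule `κ ≥ K`. [folklore] -/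
theorem isResolved_dirac_of_isLevel {K : ℕ} {U : Torus.energySpace (Fin 3)} (hU : IsLevel K U)
    {κ : ℕ → ℕ} (hκ : ∀ n, K ≤ κ n) : IsResolved κ (Measure.dirac U) := by
  haveI : MeasurableSingletonClass (Torus.energySpace (Fin 3)) :=
    OpensMeasurableSpace.toMeasurableSingletonClass
  intro n
  rw [lintegral_dirac, lintegral_dirac, eGradNormSq_fourierTruncate_of_isLevel hU (hκ n)]
  exact le_self_add

/-- A Dirac mass is supported in the ball of its own radius. [folklore] -/
theorem isSupported_dirac (U : Torus.energySpace (Fin 3)) {R : ℝ} (hR : ‖U‖ ≤ R) :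
    IsSupported R (Measure.dirac U) := by
  haveI : MeasurableSingletonClass (Torus.energySpace (Fin 3)) :=
    OpensMeasurableSpace.toMeasurableSingletonClass
  unfold IsSupported
  rw [ae_dirac_eq]
  simpa using hR

/-- WEAKENING 1 (holds trivially): `MomentLadder` without `0 < ε`. -/
def MomentLadderWithoutEpsPos : Prop :=
  ∃ f : UnitAddTorus (Fin 3) → EuclideanSpace ℝ (Fin 3),
    Torus.IsSmooth f ∧ Torus.IsDivFree f ∧ Torus.HasZeroMean f ∧
    ∃ (ν : ℕ → ℝ) (E ε : ℝ), (∀ j, 0 < ν j) ∧ Tendsto ν atTop (𝓝 0) ∧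
    ∀ j : ℕ, ∃ (R : ℝ) (κ : ℕ → ℕ), ∃ᶠ N in atTop, ∀ d : ℕ, ∃ μ,
      IsLadderWitness f (ν j) N E ε R κ d μ

/-- **`0 < ε` is load-bearing** — and every OTHER clause of the crux is jointly satisfiable: `δ₀` with
`f = 0`, `E = ε = 0`, `R = 0`, any `κ`, is a probability law, level-`N` for every `N`, supported,
resolved and stationary at EVERY order (all rows vanish identically). [folklore] -/
theorem momentLadderWithoutEpsPos_holds : MomentLadderWithoutEpsPos := by
  haveI : MeasurableSingletonClass (Torus.energySpace (Fin 3)) :=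
    OpensMeasurableSpace.toMeasurableSingletonClass
  have hzero : (Torus.realTrigPoly (∅ : Finset (Fin 3 → ℤ)) (0 : (Fin 3 → ℤ) → EuclideanSpace ℂ (Fin 3)))
      = fun _ => 0 := Torus.realTrigPoly_zero ∅
  refine ⟨fun _ => 0, Torus.isSmooth_const _, ?_, ?_, fun j => 1 / ((j : ℝ) + 1), 0, 0,
    fun j => by positivity, tendsto_one_div_add_atTop_nhds_zero_nat, fun j => ⟨0, fun _ => 0, ?_⟩⟩
  · rw [← hzero]
    exact Torus.isDivFree_realTrigPoly fun k hk => by simp at hk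
  · simp [Torus.HasZeroMean]
  refine Frequently.of_forall fun N d => ⟨Measure.dirac 0, inferInstance, ?_, isSupported_dirac 0 (by simp),
    isResolved_dirac_zero _, ?_, ?_, ?_⟩
  · rw [ae_dirac_eq]
    simp only [eventually_pure]
    intro k _
    exact mFourierCoeff_coe_zero k
  · intro m g P _ _
    refine ⟨Torus.integrable_dirac _ _, ?_⟩
    rw [integral_dirac]
    exact nsGeneratorPairing_zero_zero _ _
  · simp [Torus.ensembleEnergy, integral_dirac]
  · exact mul_nonneg (by positivity) ENNReal.toReal_nonneg

/-- `‖[K_a]‖ ≤ a` for `0 ≤ a` (`‖[K_a]‖² = a²/2`). [folklore] -/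
theorem norm_kolState_le {a : ℝ} (ha : 0 ≤ a) : ‖kolState a‖ ≤ a := by
  nlinarith [norm_nonneg (kolState a), norm_sq_kolState a]

/-- WEAKENING 2 (holds trivially): `MomentLadder` without the energy ceiling `ensembleEnergy μ ≤ E`
(everything else kept: support, resolution, stationarity at every order, loudness). -/
def MomentLadderWithoutEnergyCeiling : Prop :=
  ∃ f : UnitAddTorus (Fin 3) → EuclideanSpace ℝ (Fin 3),
    Torus.IsSmooth f ∧ Torus.IsDivFree f ∧ Torus.HasZeroMean f ∧
    ∃ (ν : ℕ → ℝ) (ε : ℝ), (∀ j, 0 < ν j) ∧ Tendsto ν atTop (𝓝 0) ∧ 0 < ε ∧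
    ∀ j : ℕ, ∃ (R : ℝ) (κ : ℕ → ℕ), ∃ᶠ N in atTop, ∀ d : ℕ, ∃ μ : Measure (Torus.energySpace (Fin 3)),
      IsProbabilityMeasure μ ∧ (∀ᵐ u ∂μ, IsLevel N u) ∧ IsSupported R μ ∧ IsResolved κ μ ∧
      IsPolyStationary (ν j) f N d μ ∧ ε ≤ Torus.ensembleDissipation (ν j) μ

/-- **The energy ceiling is load-bearing**: without it the laminar Kolmogorov Diracs
`δ_{[K_{a_j}]}`, `a_j = (4π²ν_j)⁻¹` (exact steady states at EVERY order, level 1, radius `R_j = a_j`,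
schedule `κ ≡ 1`, dissipation `(8π²ν_j)⁻¹ ≥ (8π²)⁻¹`) witness the statement for the fixed force
`K_1 = cos(2πx₁)e₀`. So the new clauses of the ladder (support, resolution) cost nothing on the
laminar branch: the content is energy-bounded loudness, as for `QuarticGate`. [folklore] -/
theorem momentLadderWithoutEnergyCeiling_holds : MomentLadderWithoutEnergyCeiling := by
  haveI : MeasurableSingletonClass (Torus.energySpace (Fin 3)) :=
    OpensMeasurableSpace.toMeasurableSingletonClass
  have hpi : 0 < Real.pi := Real.pi_pos
  refine ⟨kolField 1, isSmooth_kolField 1, isDivFree_kolField 1, hasZeroMean_kolField 1,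
    fun j => 1 / ((j : ℝ) + 1), (8 * Real.pi ^ 2)⁻¹, fun j => by positivity,
    tendsto_one_div_add_atTop_nhds_zero_nat, by positivity, fun j => ?_⟩
  set ν : ℝ := 1 / ((j : ℝ) + 1) with hν
  have hν0 : 0 < ν := by positivity
  have hν1 : ν ≤ 1 := by
    rw [hν, div_le_one (by positivity)]; linarith [(Nat.cast_nonneg j : (0 : ℝ) ≤ j)]
  set a : ℝ := (4 * Real.pi ^ 2 * ν)⁻¹ with ha
  have ha0 : 0 < a := by positivity
  have hforce : kolField 1 = kolField (4 * Real.pi ^ 2 * ν * a) := by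
    rw [ha, mul_inv_cancel₀ (by positivity)]
  refine ⟨a, fun _ => 1, (eventually_ge_atTop 1).frequently.mono fun N hN d => ?_⟩
  refine ⟨Measure.dirac (kolState a), inferInstance, ?_, isSupported_dirac _ (norm_kolState_le ha0.le),
    isResolved_dirac_of_isLevel (isLevel_kolState a le_rfl) fun _ => le_rfl, ?_, ?_⟩
  · rw [ae_dirac_eq]; simpa using isLevel_kolState a hN
  · rw [hforce]; exact isPolyStationary_dirac_kolState ν a N d
  · rw [ensembleDissipation_dirac_kolState, ha]
    have h1 : ν * (2 * Real.pi ^ 2 * ((4 * Real.pi ^ 2 * ν)⁻¹) ^ 2) = (8 * Real.pi ^ 2 * ν)⁻¹ := by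
      field_simp; ring
    rw [h1]
    exact inv_anti₀ (by positivity) (by nlinarith [hν1, hpi])

/-- WEAKENING 3 (holds trivially): `MomentLadder` without `ν_j → 0`. -/
def MomentLadderWithoutVanishingViscosity : Prop :=
  ∃ f : UnitAddTorus (Fin 3) → EuclideanSpace ℝ (Fin 3),
    Torus.IsSmooth f ∧ Torus.IsDivFree f ∧ Torus.HasZeroMean f ∧
    ∃ (ν : ℕ → ℝ) (E ε : ℝ), (∀ j, 0 < ν j) ∧ 0 < ε ∧
    ∀ j : ℕ, ∃ (R : ℝ) (κ : ℕ → ℕ), ∃ᶠ N in atTop, ∀ d : ℕ, ∃ μ,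
      IsLadderWitness f (ν j) N E ε R κ d μ

/-- **`ν_j → 0` is load-bearing**: at fixed viscosity `ν ≡ 1` the laminar Dirac `δ_{[K_a]}`,
`a = (4π²)⁻¹`, is a ladder witness at every level `N ≥ 1` and every order, with `E = a²/2`,
`ε = (8π²)⁻¹` (attaining the force floor of §C), `R = a`, `κ ≡ 1`. [folklore] -/
theorem momentLadderWithoutVanishingViscosity_holds : MomentLadderWithoutVanishingViscosity := by
  haveI : MeasurableSingletonClass (Torus.energySpace (Fin 3)) :=
    OpensMeasurableSpace.toMeasurableSingletonClass
  have hpi : 0 < Real.pi := Real.pi_pos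
  set a : ℝ := (4 * Real.pi ^ 2 * (1 : ℝ))⁻¹ with ha
  have ha0 : 0 < a := by positivity
  refine ⟨kolField 1, isSmooth_kolField 1, isDivFree_kolField 1, hasZeroMean_kolField 1,
    fun _ => 1, a ^ 2 / 2, (8 * Real.pi ^ 2 * (1 : ℝ))⁻¹, fun _ => one_pos, by positivity,
    fun j => ⟨a, fun _ => 1, (eventually_ge_atTop 1).frequently.mono fun N hN d => ?_⟩⟩
  obtain ⟨⟨hprob, hlev, -, -, hEn, hε⟩, -⟩ := isQuarticWitness_dirac_kolState one_pos hN
  have hforce : kolField 1 = kolField (4 * Real.pi ^ 2 * (1 : ℝ) * a) := by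
    rw [ha, mul_inv_cancel₀ (by positivity)]
  refine ⟨Measure.dirac (kolState a), hprob, hlev, isSupported_dirac _ (norm_kolState_le ha0.le),
    isResolved_dirac_of_isLevel (isLevel_kolState a le_rfl) fun _ => le_rfl, ?_, hEn, hε⟩
  rw [hforce]; exact isPolyStationary_dirac_kolState 1 a N d

end LoadBearing

/-! ## F. Mean flow: every witness has a mean flow `ū` with `(ū, f) ≥ ε`, `‖ū‖ ≥ ε/‖f‖₂` -/

section MeanFlow

/-- `H = L²_σ(T³)` is complete (a closed subspace of `L²(T³; ℝ³)`). [folklore] -/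
instance instCompleteSpaceEnergySpace : CompleteSpace (Torus.energySpace (Fin 3)) :=
  (Torus.isClosed_energySpace (d := Fin 3)).completeSpace_coe

/-- `2 ≠ ∞` as a `Fact` (the exponent hypothesis of Mathlib's `Lp.SecondCountableTopology`). [folklore] -/
instance instFactTwoNeTop : Fact ((2 : ℝ≥0∞) ≠ ∞) := ⟨ENNReal.ofNat_ne_top⟩

/-- `H = L²_σ(T³)` is second countable (a subspace of the separable `L²(T³; ℝ³)`,
Mathlib's `Lp.SecondCountableTopology`). [folklore] -/
instance instSecondCountableTopologyEnergySpace : SecondCountableTopology (Torus.energySpace (Fin 3)) :=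
  TopologicalSpace.Subtype.secondCountableTopology _

/-- The MEAN FLOW `ū = ∫ u dμ ∈ H` of a law on the energy space (Bochner integral in `H`). -/
def meanState (μ : Measure (Torus.energySpace (Fin 3))) : Torus.energySpace (Fin 3) :=
  ∫ u, u ∂μ

/-- The pairing with an `L²` field is a continuous linear functional on `H`. [folklore] -/
theorem pairing_eq_clm {f : UnitAddTorus (Fin 3) → EuclideanSpace ℝ (Fin 3)} (hf : MemLp f 2 volume)
    (u : Torus.energySpace (Fin 3)) :
    Torus.pairing u.1 f =
      ((innerSL ℝ (hf.toLp f)).comp (Torus.energySpace (Fin 3)).subtypeL) u := by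
  rw [ContinuousLinearMap.comp_apply, Submodule.subtypeL_apply, innerSL_apply_apply,
    real_inner_comm, Torus.pairing_eq_inner hf]

/-- **Mean injection = injection into the mean flow**: `∫ (u, f) dμ = (ū, f)` when `u` is Bochner
integrable. [folklore] -/
theorem integral_pairing_eq_pairing_meanState {f : UnitAddTorus (Fin 3) → EuclideanSpace ℝ (Fin 3)}
    (hf : MemLp f 2 volume) {μ : Measure (Torus.energySpace (Fin 3))}
    (h1 : Integrable (fun u : Torus.energySpace (Fin 3) => u) μ) :
    ∫ u, Torus.pairing u.1 f ∂μ = Torus.pairing (meanState μ).1 f := by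
  simp_rw [pairing_eq_clm hf]
  rw [ContinuousLinearMap.integral_comp_comm _ h1]
  rfl

/-- Jensen for the mean flow: `‖ū‖ ≤ √(ensembleEnergy μ)` on a probability law with integrable
energy. [folklore] -/
theorem norm_meanState_le {μ : Measure (Torus.energySpace (Fin 3))} [IsProbabilityMeasure μ]
    (h2 : Integrable (fun u : Torus.energySpace (Fin 3) => ‖u‖ ^ 2) μ) :
    ‖meanState μ‖ ≤ Real.sqrt (Torus.ensembleEnergy μ) := by
  have hsq := Summit.AnomalousDissipation.AnomalousDissipation.Theorems.CubicParityLoud.Negative.sq_integral_norm_le h2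
  calc ‖meanState μ‖ ≤ ∫ u, ‖u‖ ∂μ := norm_integral_le_integral_norm _
    _ ≤ Real.sqrt (∫ u, ‖u‖ ^ 2 ∂μ) := Real.le_sqrt_of_sq_le hsq
    _ = Real.sqrt (Torus.ensembleEnergy μ) := rfl

/-- A supported law has a Bochner-integrable identity. [folklore] -/
theorem integrable_id_of_isSupported {μ : Measure (Torus.energySpace (Fin 3))} [IsFiniteMeasure μ]
    {R : ℝ} (hR : IsSupported R μ) : Integrable (fun u : Torus.energySpace (Fin 3) => u) μ :=
  Integrable.mono' (integrable_const (max R 0)) continuous_id.aestronglyMeasurable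
    (Filter.Eventually.mono hR fun _ hu => hu.trans (le_max_left _ _))

/-- **Dissipation = injection into the mean flow** for a ladder witness of order `≥ 3`:
`ensembleDissipation ν μ = (ū, f)`. [folklore] -/
theorem IsLadderWitness.dissipation_eq_pairing_meanState {f : UnitAddTorus (Fin 3) → EuclideanSpace ℝ (Fin 3)}
    (hf : MemLp f 2 volume) {ν : ℝ} {N : ℕ} {E ε R : ℝ} {κ : ℕ → ℕ} {d : ℕ}
    {μ : Measure (Torus.energySpace (Fin 3))} (h : IsLadderWitness f ν N E ε R κ d μ) (hd : 3 ≤ d) :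
    Torus.ensembleDissipation ν μ = Torus.pairing (meanState μ).1 f := by
  have h1 := h.dissipation_eq hf hd
  obtain ⟨hprob, -, hsupp, -, -, -, -⟩ := h
  rw [h1, integral_pairing_eq_pairing_meanState hf (integrable_id_of_isSupported hsupp)]

/-- **MEAN-FLOW FLOOR**: `ε ≤ (ū, f) ≤ ‖f‖₂ ‖ū‖` and `‖ū‖ ≤ √E` for every ladder witness of order
`≥ 3`: the mean flow is non-zero, of norm `≥ ε/‖f‖₂`, and positively correlated with the force. [folklore] -/
theorem IsLadderWitness.meanFlow_floor {f : UnitAddTorus (Fin 3) → EuclideanSpace ℝ (Fin 3)}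
    (hf : MemLp f 2 volume) {ν : ℝ} {N : ℕ} {E ε R : ℝ} {κ : ℕ → ℕ} {d : ℕ}
    {μ : Measure (Torus.energySpace (Fin 3))} (h : IsLadderWitness f ν N E ε R κ d μ) (hd : 3 ≤ d) :
    ε ≤ Torus.pairing (meanState μ).1 f ∧
      Torus.pairing (meanState μ).1 f ≤ Real.sqrt (∫ x, ‖f x‖ ^ 2) * ‖meanState μ‖ ∧
      ‖meanState μ‖ ≤ Real.sqrt E := by
  have h1 := h.dissipation_eq_pairing_meanState hf hd
  obtain ⟨hprob, -, hsupp, -, -, hEn, hε⟩ := h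
  refine ⟨h1 ▸ hε, ?_, ?_⟩
  · have := (le_abs_self _).trans (Torus.abs_pairing_coe_le hf (meanState μ))
    rwa [Torus.norm_toLp_eq_sqrt hf, mul_comm] at this
  · exact (norm_meanState_le (integrable_norm_pow_of_isSupported hsupp 2)).trans (Real.sqrt_le_sqrt hEn)

/-- A witness of order `≥ 3` with `ε > 0` has a non-zero mean flow. [folklore] -/
theorem IsLadderWitness.meanState_ne_zero {f : UnitAddTorus (Fin 3) → EuclideanSpace ℝ (Fin 3)}
    (hf : MemLp f 2 volume) {ν : ℝ} {N : ℕ} {E ε R : ℝ} (hε : 0 < ε) {κ : ℕ → ℕ} {d : ℕ}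
    {μ : Measure (Torus.energySpace (Fin 3))} (h : IsLadderWitness f ν N E ε R κ d μ) (hd : 3 ≤ d) :
    meanState μ ≠ 0 := fun h0 => by
  obtain ⟨h1, h2, -⟩ := h.meanFlow_floor hf hd
  rw [h0] at h1 h2
  rw [norm_zero, mul_zero] at h2
  linarith

/-- NATURAL STRENGTHENING 5 (refuted): a witnessing family with ZERO MEAN FLOW (e.g. laws symmetric
under `u ↦ −u`, isotropic ensembles, Gibbs-type equilibria of truncated Euler). -/
def MomentLadderZeroMeanFlow : Prop :=
  ∃ f : UnitAddTorus (Fin 3) → EuclideanSpace ℝ (Fin 3),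
    Torus.IsSmooth f ∧ Torus.IsDivFree f ∧ Torus.HasZeroMean f ∧
    ∃ (ν : ℕ → ℝ) (E ε : ℝ), (∀ j, 0 < ν j) ∧ Tendsto ν atTop (𝓝 0) ∧ 0 < ε ∧
    ∀ j : ℕ, ∃ (R : ℝ) (κ : ℕ → ℕ), ∃ᶠ N in atTop, ∀ d : ℕ, ∃ μ,
      IsLadderWitness f (ν j) N E ε R κ d μ ∧ meanState μ = 0

/-- **`¬ MomentLadderZeroMeanFlow`**: loudness IS mean-flow/force correlation (`ε ≤ (ū, f)`), so no
symmetric or isotropic ensemble — in particular no absolute-equilibrium (Gibbs) ensemble of truncated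
Euler, whose mean vanishes — can witness the ladder; the witness must carry a coherent mean flow of
size `≥ ε/‖f‖₂` at energy `≤ E`, uniformly as `ν_j → 0`. [folklore] -/
theorem not_momentLadderZeroMeanFlow : ¬ MomentLadderZeroMeanFlow := by
  rintro ⟨f, hfs, -, -, ν, E, ε, hν, -, hε, hj⟩
  obtain ⟨R, κ, hfreq⟩ := hj 0
  obtain ⟨N, hN⟩ := hfreq.exists
  obtain ⟨μ, hμ, h0⟩ := hN 3
  exact hμ.meanState_ne_zero (hfs.memLp 2) hε le_rfl h0

end MeanFlow

/-! ## G. Transfer to `CubicParityLoud`'s witness bundle: laminar (Poincaré) ceiling `ε ≤ ‖f‖₂²/(4π²ν_j)` -/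

section Laminar

/-- A ladder witness of order `d ≥ 3` is a witness of the sibling crux `CubicParityLoud` at `(f, ν, N)`
(third moments from the support clause, 3-stationarity from `d`-stationarity). [folklore] -/
theorem IsLadderWitness.isCubicWitness {f : UnitAddTorus (Fin 3) → EuclideanSpace ℝ (Fin 3)} {ν : ℝ}
    {N : ℕ} {E ε R : ℝ} {κ : ℕ → ℕ} {d : ℕ} {μ : Measure (Torus.energySpace (Fin 3))}
    (h : IsLadderWitness f ν N E ε R κ d μ) (hd : 3 ≤ d) :
    Summit.AnomalousDissipation.AnomalousDissipation.Theorems.CubicParityLoud.Negative.IsWitness f ν N E ε μ := by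
  obtain ⟨hprob, hlev, hsupp, -, hstat, hEn, hε⟩ := h
  exact ⟨hprob, hlev, integrable_norm_pow_of_isSupported hsupp 3, hstat.isStationary3 hd, hEn, hε⟩

/-- **LAMINAR (Poincaré) CEILING**: `ε ≤ ‖f‖₂² / (4π²ν)` for every ladder witness of order `≥ 3` with
`ε > 0` (energy row + Poincaré in the mean + Cauchy–Schwarz; landed as the sibling's `IsWitness.laminar`).
So the witnessing viscosities satisfy `ν_j ≤ ‖f‖₂²/(4π²ε)` for EVERY `j`: the budgets bound `sup_j ν_j`.
Tight: the laminar Kolmogorov Dirac attains it (`(8π²ν)⁻¹ = ‖K_1‖₂²/(4π²ν)`, `‖K_1‖₂² = 1/2`). [folklore] -/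
theorem IsLadderWitness.eps_le_laminar {f : UnitAddTorus (Fin 3) → EuclideanSpace ℝ (Fin 3)}
    (hf : MemLp f 2 volume) {ν : ℝ} (hν : 0 < ν) {N : ℕ} {E ε R : ℝ} (hε : 0 < ε) {κ : ℕ → ℕ} {d : ℕ}
    {μ : Measure (Torus.energySpace (Fin 3))} (h : IsLadderWitness f ν N E ε R κ d μ) (hd : 3 ≤ d) :
    ε ≤ (∫ x, ‖f x‖ ^ 2) / (4 * Real.pi ^ 2 * ν) :=
  Summit.AnomalousDissipation.AnomalousDissipation.Theorems.CubicParityLoud.Negative.IsWitness.laminar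
    hf hν hε (h.isCubicWitness hd)

/-- NATURAL STRENGTHENING 6 (refuted): budgets `E`, `ε` depending on the force only — i.e. chosen BEFORE
the viscosity sequence, which is then arbitrary (`∃ f E ε ∀ ν`). -/
def MomentLadderBudgetsBeforeViscosities : Prop :=
  ∃ f : UnitAddTorus (Fin 3) → EuclideanSpace ℝ (Fin 3),
    Torus.IsSmooth f ∧ Torus.IsDivFree f ∧ Torus.HasZeroMean f ∧
    ∃ (E ε : ℝ), 0 < ε ∧ ∀ ν : ℕ → ℝ, (∀ j, 0 < ν j) → Tendsto ν atTop (𝓝 0) →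
    ∀ j : ℕ, ∃ (R : ℝ) (κ : ℕ → ℕ), ∃ᶠ N in atTop, ∀ d : ℕ, ∃ μ,
      IsLadderWitness f (ν j) N E ε R κ d μ

/-- **`¬ MomentLadderBudgetsBeforeViscosities`**: by the laminar ceiling no witness exists at a viscosity
`ν_j > ‖f‖₂²/(4π²ε)`, and a vanishing sequence may start anywhere (`ν_j = M/(j+1)`). Only the trivial
large-viscosity regime is involved; the information for provers is the quantitative one, `sup_j ν_j ≤
‖f‖₂²/(4π²ε)` (together with `E ≥ (ε/‖f‖₂)²`, `N_j, κ_j(0) ≳ ν_j^{-1/2}`). [folklore] -/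
theorem not_momentLadderBudgetsBeforeViscosities : ¬ MomentLadderBudgetsBeforeViscosities := by
  rintro ⟨f, hfs, -, -, E, ε, hε, hall⟩
  set A2 : ℝ := ∫ x, ‖f x‖ ^ 2 with hA2
  have hA0 : 0 ≤ A2 := integral_nonneg fun _ => by positivity
  set M : ℝ := (A2 + 1) / (2 * Real.pi ^ 2 * ε) with hM
  have hMpos : 0 < M := by positivity
  have hν : ∀ j : ℕ, 0 < M / ((j : ℝ) + 1) := fun j => by positivity
  have hν0 : Tendsto (fun j : ℕ => M / ((j : ℝ) + 1)) atTop (𝓝 0) := by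
    have h := tendsto_one_div_add_atTop_nhds_zero_nat.const_mul M
    rw [mul_zero] at h
    refine h.congr fun j => ?_
    rw [mul_one_div]
  obtain ⟨R, κ, hfreq⟩ := hall (fun j => M / ((j : ℝ) + 1)) hν hν0 0
  obtain ⟨N, hN⟩ := hfreq.exists
  obtain ⟨μ, hμ⟩ := hN 3
  have hlam := hμ.eps_le_laminar (hfs.memLp 2) (hν 0) hε le_rfl
  simp only [Nat.cast_zero, zero_add, div_one] at hlam
  have hden : 0 < 4 * Real.pi ^ 2 * M := by positivity
  rw [← hA2, le_div_iff₀ hden] at hlam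
  have : ε * (4 * Real.pi ^ 2 * M) = 2 * (A2 + 1) := by
    rw [hM]
    field_simp
    ring
  linarith

end Laminar

/-! ## E. What a refutation must prove -/

section Shape

/-- **`¬ MomentLadder` unfolded**: a refutation is a UNIFORM QUIETNESS THEOREM — for every admissible
force, every positive `ν_j → 0` and all budgets, SOME viscosity `ν_j` is such that for EVERY radius
`R` and EVERY schedule `κ`, at all but finitely many levels `N` some order `d` admits no supported,
resolved, loud `d`-stationary level-`N` law. By `MomentClosure` (support item) this is: no loud
Galerkin-INVARIANT law of energy `≤ E` supported in `B_R` is `κ`-resolved, frequently in `N` — i.e.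
every bounded-energy family of invariant measures of 3-D Galerkin NS either laminarises
(`(f, ū) → 0`) N-frequently as `ν → 0`, or leaks enstrophy beyond every fixed cutoff as `N → ∞` at
fixed `ν`. Open both ways (it would be a converged-DNS "no zeroth law"). [folklore] -/
theorem not_momentLadder_iff :
    ¬ MomentLadder ↔ ∀ f : UnitAddTorus (Fin 3) → EuclideanSpace ℝ (Fin 3),
      Torus.IsSmooth f → Torus.IsDivFree f → Torus.HasZeroMean f →
      ∀ (ν : ℕ → ℝ) (E ε : ℝ), (∀ j, 0 < ν j) → Tendsto ν atTop (𝓝 0) → 0 < ε →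
      ∃ j : ℕ, ∀ (R : ℝ) (κ : ℕ → ℕ), ∀ᶠ N in atTop, ∃ d : ℕ, ∀ μ,
        ¬ IsLadderWitness f (ν j) N E ε R κ d μ := by
  rw [momentLadder_iff]
  simp only [not_exists, not_and, not_forall, Filter.not_frequently]

end Shape

end

end Summit.AnomalousDissipation.AnomalousDissipation.Cruxes.MomentLadder.Disproof
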